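import Mathlib
import Summits.AtomisticToContinuum.Crystallization.Theses.PhononSlackCertificates
import Summits.AtomisticToContinuum.Crystallization.Theorems.PhononSlackCertificatesNearFarGlueRCore
import Summits.AtomisticToContinuum.Crystallization.Theorems.PhononSlackCertificatesNearFarGlueRLooseReduction
import Literature.MathematicalPhysics.StatisticalMechanics.LennardJonesClusters

/-!
# Crux `PhononSlackCertificates.NearFarGlueR` (stmt-AtomisticToContinuum-14970), line `Sketch`:
the CORE normal form of the residual and of the target (registered sub-goal `stub_coreReduction`)

Continuation lead c4, part 3c.  From core exhaustion (`exists_core`, part 3b):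

* `tightContact_ineq_of_core`, `tightContactGap_iff_core`: for every `θ ∈ [0, 0.711)` and `g > 0`
  the registered residual `stub_tightContactGap` (∀ δ > 0 ∃ g₂ > 0 …, tight contact gap) is
  EQUIVALENT to its instance on CORES — `3/10`-separated, `θ`-well-bonded, `g`-hole-free
  configurations — and then holds with `min g₂ (min(0.711 − θ, g)/5833)` everywhere;
* `coercive_ineq_of_core`, `coerciveTwoShellGap_iff_core`: the same for the target
  `CoerciveTwoShellGap` (constant `1332`);
* `nearFarGlueR_iff_core`: the crux as typed says exactly that its antecedents yield the tight
  contact gap on KINK-BOUND (`θ = 0.71`), `0.01`-hole-free, `3/10`-separated configurations;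
  `coerciveTwoShellGap_iff_allBadGap_and_core`: the target is `AllBadGap` ∧ that core instance.

Species ledger after c4: priced `e*`-free or by the two certified cones `−0.7865 ≤ e* ≤ −0.711` —
loose particles (c3), deep holes / vacancies (c4), missing-bond defects of exact fcc / hcp pieces
(c1, c2), dense-cloud crowding and unbound matter (normalised away, c3/c4).  NOT priced: the
well-bonded, hole-free interface — relaxed free surfaces, strained or displaced cages, grain
boundaries, dislocation cores next to good crystal — which needs `e*` to `~1e-3` or phonon
coercivity AT the interface: the thin half of 3-D Lennard-Jones crystallization.  All `[folklore]`.
-/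

noncomputable section

namespace Summit.AtomisticToContinuum.Crystallization.Theorems.PhononSlackCertificatesNearFarGlueR

open Literature.MathematicalPhysics.StatisticalMechanics
open Literature.Geometry.DiscreteGeometry
open Summit.AtomisticToContinuum.Crystallization.Theses.PhononSlackCertificates
open scoped BigOperators

/-! ## The residual and the target live on cores -/

/-- **The residual reduces to cores.**  If the tight contact gap `K·e* + g_c·#T(z) ≤ 𝓔(z)` holds
with ONE `g_c ≥ 0` for every core `z` (`3/10`-separated, `θ`-well-bonded, `g`-hole-free;
`0 ≤ θ < 0.711`, `g > 0`), then `N·e* + min g_c (min(0.711 − θ, g)/5833)·#T(x) ≤ 𝓔(x)` for EVERY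
finite injective `x`. [folklore] -/
theorem tightContact_ineq_of_core {gc θ g : ℝ} (hgc : 0 ≤ gc) (hθ0 : 0 ≤ θ) (hθ : θ < 711 / 1000)
    (hg : 0 < g)
    (H : ∀ (K : ℕ) (z : Fin K → EuclideanSpace ℝ (Fin 3)),
      (∀ i j : Fin K, i ≠ j → (3 / 10 : ℝ) ≤ dist (z i) (z j)) →
      (∀ j : Fin K, ∑ k ∈ Finset.univ.erase j,
        (min (lennardJones (dist (z j) (z k))) 0 +
          (1 / 2 : ℝ) * max (lennardJones (dist (z j) (z k))) 0) < -θ) →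
      (∀ p : EuclideanSpace ℝ (Fin 3), (∀ i : Fin K, (3 / 10 : ℝ) ≤ dist p (z i)) →
        -(98309653 / 125000000 : ℝ) - g < ∑ i, lennardJones (dist p (z i))) →
      (K : ℝ) * (⨅ Q : PeriodicConfiguration 3, Q.energyPerParticle lennardJones) +
          gc * (Nat.card {k : Fin K // ¬ IsTwoShellGood (1 / 20) (47 / 50) 1 z k ∧
            ∃ i : Fin K, IsTwoShellGood (1 / 20) (47 / 50) 1 z i ∧ dist (z i) (z k) ≤ 21 / 20} : ℝ) ≤
        interactionEnergy lennardJones z)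
    {N : ℕ} (x : Fin N → EuclideanSpace ℝ (Fin 3)) (hx : Function.Injective x) :
    (N : ℝ) * (⨅ Q : PeriodicConfiguration 3, Q.energyPerParticle lennardJones) +
        min gc (min (711 / 1000 - θ) g / 5833) *
          (Nat.card {j : Fin N // ¬ IsTwoShellGood (1 / 20) (47 / 50) 1 x j ∧
            ∃ i : Fin N, IsTwoShellGood (1 / 20) (47 / 50) 1 x i ∧ dist (x i) (x j) ≤ 21 / 20} : ℝ) ≤
      interactionEnergy lennardJones x := by
  obtain ⟨K, z, u, hzsep, hzwb, hzhf, hEz, hTz, -⟩ := exists_core hθ0 hθ hg x hx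
  have hH := H K z hzsep hzwb hzhf
  set c : ℝ := min (711 / 1000 - θ) g with hc
  have hc0 : 0 < c := lt_min (by linarith) hg
  set m : ℝ := min gc (c / 5833) with hm
  have hm0 : 0 ≤ m := le_min hgc (by positivity)
  have hmg : m ≤ gc := min_le_left _ _
  have hm2 : m * 5833 ≤ c := by
    have : m ≤ c / 5833 := min_le_right _ _
    rw [le_div_iff₀ (by norm_num : (0 : ℝ) < 5833)] at this
    linarith
  set tN : ℝ := (Nat.card {j : Fin N // ¬ IsTwoShellGood (1 / 20) (47 / 50) 1 x j ∧
      ∃ i : Fin N, IsTwoShellGood (1 / 20) (47 / 50) 1 x i ∧ dist (x i) (x j) ≤ 21 / 20} : ℝ) with htN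
  set tK : ℝ := (Nat.card {k : Fin K // ¬ IsTwoShellGood (1 / 20) (47 / 50) 1 z k ∧
      ∃ i : Fin K, IsTwoShellGood (1 / 20) (47 / 50) 1 z i ∧ dist (z i) (z k) ≤ 21 / 20} : ℝ) with htK
  have htK0 : 0 ≤ tK := Nat.cast_nonneg _
  have hu0 : (0 : ℝ) ≤ u := Nat.cast_nonneg _
  have h1 : m * tN ≤ m * tK + m * 5833 * u := by
    have := mul_le_mul_of_nonneg_left hTz hm0
    nlinarith [this]
  have h2 : m * tK ≤ gc * tK := mul_le_mul_of_nonneg_right hmg htK0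
  have h3 : m * 5833 * u ≤ c * u := mul_le_mul_of_nonneg_right hm2 hu0
  have hH' : (K : ℝ) * (⨅ Q : PeriodicConfiguration 3, Q.energyPerParticle lennardJones) + gc * tK ≤
      interactionEnergy lennardJones z := hH
  have hEz' : interactionEnergy lennardJones z -
      (K : ℝ) * (⨅ Q : PeriodicConfiguration 3, Q.energyPerParticle lennardJones) + c * u ≤
      interactionEnergy lennardJones x -
        (N : ℝ) * (⨅ Q : PeriodicConfiguration 3, Q.energyPerParticle lennardJones) := hEz
  linarith [hEz', hH', h1, h2, h3]

/-- **The registered residual is equivalent to its instance on CORES** (`0 ≤ θ < 0.711`, `g > 0`):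
it suffices to prove the tight contact gap, with one `g₂ > 0`, for configurations that are
`3/10`-separated, `θ`-well-bonded (every particle bound at least kink-like for `θ ≈ 0.71`) and
`g`-hole-free (no vacant site binding a test particle by more than `0.7865 + g`). [folklore] -/
theorem tightContactGap_iff_core {θ g : ℝ} (hθ0 : 0 ≤ θ) (hθ : θ < 711 / 1000) (hg : 0 < g) :
    (∀ δ : ℝ, 0 < δ → ∃ g₂ : ℝ, 0 < g₂ ∧ ∀ (N : ℕ) (x : Fin N → EuclideanSpace ℝ (Fin 3)),
      (∀ i j : Fin N, i ≠ j → δ ≤ dist (x i) (x j)) →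
      (N : ℝ) * (⨅ Q : PeriodicConfiguration 3, Q.energyPerParticle lennardJones)
        + g₂ * (Nat.card {j : Fin N // ¬ IsTwoShellGood (1 / 20) (47 / 50) 1 x j ∧
            ∃ i : Fin N, IsTwoShellGood (1 / 20) (47 / 50) 1 x i ∧ dist (x i) (x j) ≤ 21 / 20} : ℝ)
        ≤ interactionEnergy lennardJones x) ↔
    (∃ g₂ : ℝ, 0 < g₂ ∧ ∀ (K : ℕ) (z : Fin K → EuclideanSpace ℝ (Fin 3)),
      (∀ i j : Fin K, i ≠ j → (3 / 10 : ℝ) ≤ dist (z i) (z j)) →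
      (∀ j : Fin K, ∑ k ∈ Finset.univ.erase j,
        (min (lennardJones (dist (z j) (z k))) 0 +
          (1 / 2 : ℝ) * max (lennardJones (dist (z j) (z k))) 0) < -θ) →
      (∀ p : EuclideanSpace ℝ (Fin 3), (∀ i : Fin K, (3 / 10 : ℝ) ≤ dist p (z i)) →
        -(98309653 / 125000000 : ℝ) - g < ∑ i, lennardJones (dist p (z i))) →
      (K : ℝ) * (⨅ Q : PeriodicConfiguration 3, Q.energyPerParticle lennardJones)
        + g₂ * (Nat.card {k : Fin K // ¬ IsTwoShellGood (1 / 20) (47 / 50) 1 z k ∧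
            ∃ i : Fin K, IsTwoShellGood (1 / 20) (47 / 50) 1 z i ∧ dist (z i) (z k) ≤ 21 / 20} : ℝ)
        ≤ interactionEnergy lennardJones z) := by
  constructor
  · intro h
    obtain ⟨g₂, hg₂, H⟩ := h (3 / 10) (by norm_num)
    exact ⟨g₂, hg₂, fun K z hzsep _ _ => H K z hzsep⟩
  · rintro ⟨gc, hgc, H⟩ δ hδ
    refine ⟨min gc (min (711 / 1000 - θ) g / 5833),
      lt_min hgc (div_pos (lt_min (by linarith) hg) (by norm_num)), fun N x hsep => ?_⟩
    exact tightContact_ineq_of_core hgc.le hθ0 hθ hg H x (fibre_injective_of_separated hδ hsep)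

/-- **The target reduces to cores.**  If `K·e* + g_c·#bad(z) ≤ 𝓔(z)` with one `g_c ≥ 0` for every
core `z`, then `N·e* + min g_c (min(0.711 − θ, g)/1332)·#bad(x) ≤ 𝓔(x)` for every finite injective
`x`. [folklore] -/
theorem coercive_ineq_of_core {gc θ g : ℝ} (hgc : 0 ≤ gc) (hθ0 : 0 ≤ θ) (hθ : θ < 711 / 1000)
    (hg : 0 < g)
    (H : ∀ (K : ℕ) (z : Fin K → EuclideanSpace ℝ (Fin 3)),
      (∀ i j : Fin K, i ≠ j → (3 / 10 : ℝ) ≤ dist (z i) (z j)) →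
      (∀ j : Fin K, ∑ k ∈ Finset.univ.erase j,
        (min (lennardJones (dist (z j) (z k))) 0 +
          (1 / 2 : ℝ) * max (lennardJones (dist (z j) (z k))) 0) < -θ) →
      (∀ p : EuclideanSpace ℝ (Fin 3), (∀ i : Fin K, (3 / 10 : ℝ) ≤ dist p (z i)) →
        -(98309653 / 125000000 : ℝ) - g < ∑ i, lennardJones (dist p (z i))) →
      (K : ℝ) * (⨅ Q : PeriodicConfiguration 3, Q.energyPerParticle lennardJones) +
          gc * (Nat.card {k : Fin K // ¬ IsTwoShellGood (1 / 20) (47 / 50) 1 z k} : ℝ) ≤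
        interactionEnergy lennardJones z)
    {N : ℕ} (x : Fin N → EuclideanSpace ℝ (Fin 3)) (hx : Function.Injective x) :
    (N : ℝ) * (⨅ Q : PeriodicConfiguration 3, Q.energyPerParticle lennardJones) +
        min gc (min (711 / 1000 - θ) g / 1332) *
          (Nat.card {i : Fin N // ¬ IsTwoShellGood (1 / 20) (47 / 50) 1 x i} : ℝ) ≤
      interactionEnergy lennardJones x := by
  obtain ⟨K, z, u, hzsep, hzwb, hzhf, hEz, -, hBz⟩ := exists_core hθ0 hθ hg x hx
  have hH := H K z hzsep hzwb hzhf
  set c : ℝ := min (711 / 1000 - θ) g with hc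
  have hc0 : 0 < c := lt_min (by linarith) hg
  set m : ℝ := min gc (c / 1332) with hm
  have hm0 : 0 ≤ m := le_min hgc (by positivity)
  have hmg : m ≤ gc := min_le_left _ _
  have hm2 : m * 1332 ≤ c := by
    have : m ≤ c / 1332 := min_le_right _ _
    rw [le_div_iff₀ (by norm_num : (0 : ℝ) < 1332)] at this
    linarith
  set bN : ℝ := (Nat.card {i : Fin N // ¬ IsTwoShellGood (1 / 20) (47 / 50) 1 x i} : ℝ) with hbN
  set bK : ℝ := (Nat.card {k : Fin K // ¬ IsTwoShellGood (1 / 20) (47 / 50) 1 z k} : ℝ) with hbK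
  have hbK0 : 0 ≤ bK := Nat.cast_nonneg _
  have hu0 : (0 : ℝ) ≤ u := Nat.cast_nonneg _
  have h1 : m * bN ≤ m * bK + m * 1332 * u := by
    have := mul_le_mul_of_nonneg_left hBz hm0
    nlinarith [this]
  have h2 : m * bK ≤ gc * bK := mul_le_mul_of_nonneg_right hmg hbK0
  have h3 : m * 1332 * u ≤ c * u := mul_le_mul_of_nonneg_right hm2 hu0
  have hH' : (K : ℝ) * (⨅ Q : PeriodicConfiguration 3, Q.energyPerParticle lennardJones) + gc * bK ≤
      interactionEnergy lennardJones z := hH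
  have hEz' : interactionEnergy lennardJones z -
      (K : ℝ) * (⨅ Q : PeriodicConfiguration 3, Q.energyPerParticle lennardJones) + c * u ≤
      interactionEnergy lennardJones x -
        (N : ℝ) * (⨅ Q : PeriodicConfiguration 3, Q.energyPerParticle lennardJones) := hEz
  linarith [hEz', hH', h1, h2, h3]

/-- **The target is equivalent to its instance on cores** (`0 ≤ θ < 0.711`, `g > 0`). [folklore] -/
theorem coerciveTwoShellGap_iff_core {θ g : ℝ} (hθ0 : 0 ≤ θ) (hθ : θ < 711 / 1000) (hg : 0 < g) :
    CoerciveTwoShellGap ↔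
    (∃ g₀ : ℝ, 0 < g₀ ∧ ∀ (K : ℕ) (z : Fin K → EuclideanSpace ℝ (Fin 3)),
      (∀ i j : Fin K, i ≠ j → (3 / 10 : ℝ) ≤ dist (z i) (z j)) →
      (∀ j : Fin K, ∑ k ∈ Finset.univ.erase j,
        (min (lennardJones (dist (z j) (z k))) 0 +
          (1 / 2 : ℝ) * max (lennardJones (dist (z j) (z k))) 0) < -θ) →
      (∀ p : EuclideanSpace ℝ (Fin 3), (∀ i : Fin K, (3 / 10 : ℝ) ≤ dist p (z i)) →
        -(98309653 / 125000000 : ℝ) - g < ∑ i, lennardJones (dist p (z i))) →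
      (K : ℝ) * (⨅ Q : PeriodicConfiguration 3, Q.energyPerParticle lennardJones) +
          g₀ * (Nat.card {k : Fin K // ¬ IsTwoShellGood (1 / 20) (47 / 50) 1 z k} : ℝ) ≤
        interactionEnergy lennardJones z) := by
  constructor
  · intro h
    obtain ⟨g₀, hg₀, H⟩ := h (3 / 10) (by norm_num)
    exact ⟨g₀, hg₀, fun K z hzsep _ _ => H K z hzsep⟩
  · rintro ⟨gc, hgc, H⟩ δ hδ
    refine ⟨min gc (min (711 / 1000 - θ) g / 1332),
      lt_min hgc (div_pos (lt_min (by linarith) hg) (by norm_num)), fun N x hsep => ?_⟩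
    exact coercive_ineq_of_core hgc.le hθ0 hθ hg H x (fibre_injective_of_separated hδ hsep)

/-- **The crux as typed, on cores**: `NearFarGlueR` says exactly that its two antecedents yield
the tight contact gap on KINK-BOUND (`θ = 71/100`), `1/100`-hole-free, `3/10`-separated
configurations (composition of the landed `nearFarGlueR_iff`, p107452, with
`tightContactGap_iff_core`). [folklore] -/
theorem nearFarGlueR_iff_core :
    NearFarGlueR ↔ (FarFieldGapR → NearFieldConvexity →
      ∃ g₂ : ℝ, 0 < g₂ ∧ ∀ (K : ℕ) (z : Fin K → EuclideanSpace ℝ (Fin 3)),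
        (∀ i j : Fin K, i ≠ j → (3 / 10 : ℝ) ≤ dist (z i) (z j)) →
        (∀ j : Fin K, ∑ k ∈ Finset.univ.erase j,
          (min (lennardJones (dist (z j) (z k))) 0 +
            (1 / 2 : ℝ) * max (lennardJones (dist (z j) (z k))) 0) < -(71 / 100 : ℝ)) →
        (∀ p : EuclideanSpace ℝ (Fin 3), (∀ i : Fin K, (3 / 10 : ℝ) ≤ dist p (z i)) →
          -(98309653 / 125000000 : ℝ) - 1 / 100 < ∑ i, lennardJones (dist p (z i))) →
        (K : ℝ) * (⨅ Q : PeriodicConfiguration 3, Q.energyPerParticle lennardJones)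
          + g₂ * (Nat.card {k : Fin K // ¬ IsTwoShellGood (1 / 20) (47 / 50) 1 z k ∧
              ∃ i : Fin K, IsTwoShellGood (1 / 20) (47 / 50) 1 z i ∧ dist (z i) (z k) ≤ 21 / 20} : ℝ)
          ≤ interactionEnergy lennardJones z) := by
  rw [nearFarGlueR_iff, tightContactGap_iff_core (θ := 71 / 100) (g := 1 / 100) (by norm_num)
    (by norm_num) (by norm_num)]

/-- **The target is exactly all-bad bulk gap ∧ the tight contact gap on cores** (kink-bound,
`1/100`-hole-free, `3/10`-separated; composition with the landed structure theorem
`coerciveTwoShellGap_iff_allBadGap_and_tightContactGap`, p125405). [folklore] -/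
theorem coerciveTwoShellGap_iff_allBadGap_and_core :
    CoerciveTwoShellGap ↔ AllBadGap ∧
      ∃ g₂ : ℝ, 0 < g₂ ∧ ∀ (K : ℕ) (z : Fin K → EuclideanSpace ℝ (Fin 3)),
        (∀ i j : Fin K, i ≠ j → (3 / 10 : ℝ) ≤ dist (z i) (z j)) →
        (∀ j : Fin K, ∑ k ∈ Finset.univ.erase j,
          (min (lennardJones (dist (z j) (z k))) 0 +
            (1 / 2 : ℝ) * max (lennardJones (dist (z j) (z k))) 0) < -(71 / 100 : ℝ)) →
        (∀ p : EuclideanSpace ℝ (Fin 3), (∀ i : Fin K, (3 / 10 : ℝ) ≤ dist p (z i)) →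
          -(98309653 / 125000000 : ℝ) - 1 / 100 < ∑ i, lennardJones (dist p (z i))) →
        (K : ℝ) * (⨅ Q : PeriodicConfiguration 3, Q.energyPerParticle lennardJones)
          + g₂ * (Nat.card {k : Fin K // ¬ IsTwoShellGood (1 / 20) (47 / 50) 1 z k ∧
              ∃ i : Fin K, IsTwoShellGood (1 / 20) (47 / 50) 1 z i ∧ dist (z i) (z k) ≤ 21 / 20} : ℝ)
          ≤ interactionEnergy lennardJones z := by
  rw [coerciveTwoShellGap_iff_allBadGap_and_tightContactGap,
    tightContactGap_iff_core (θ := 71 / 100) (g := 1 / 100) (by norm_num) (by norm_num) (by norm_num)]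

/-- **Registered sub-goal `stub_coreReduction` of the crux item** (skeleton `Lines/Sketch.lean`,
c4): the residual is equivalent to its instance on cores — `tightContactGap_iff_core` in closed
form. [folklore] -/
theorem stub_coreReduction :
    ∀ θ g : ℝ, 0 ≤ θ → θ < 711 / 1000 → 0 < g →
    ((∀ δ : ℝ, 0 < δ → ∃ g₂ : ℝ, 0 < g₂ ∧ ∀ (N : ℕ) (x : Fin N → EuclideanSpace ℝ (Fin 3)),
      (∀ i j : Fin N, i ≠ j → δ ≤ dist (x i) (x j)) →
      (N : ℝ) * (⨅ Q : PeriodicConfiguration 3, Q.energyPerParticle lennardJones)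
        + g₂ * (Nat.card {j : Fin N // ¬ IsTwoShellGood (1 / 20) (47 / 50) 1 x j ∧
            ∃ i : Fin N, IsTwoShellGood (1 / 20) (47 / 50) 1 x i ∧ dist (x i) (x j) ≤ 21 / 20} : ℝ)
        ≤ interactionEnergy lennardJones x) ↔
    (∃ g₂ : ℝ, 0 < g₂ ∧ ∀ (K : ℕ) (z : Fin K → EuclideanSpace ℝ (Fin 3)),
      (∀ i j : Fin K, i ≠ j → (3 / 10 : ℝ) ≤ dist (z i) (z j)) →
      (∀ j : Fin K, ∑ k ∈ Finset.univ.erase j,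
        (min (lennardJones (dist (z j) (z k))) 0 +
          (1 / 2 : ℝ) * max (lennardJones (dist (z j) (z k))) 0) < -θ) →
      (∀ p : EuclideanSpace ℝ (Fin 3), (∀ i : Fin K, (3 / 10 : ℝ) ≤ dist p (z i)) →
        -(98309653 / 125000000 : ℝ) - g < ∑ i, lennardJones (dist p (z i))) →
      (K : ℝ) * (⨅ Q : PeriodicConfiguration 3, Q.energyPerParticle lennardJones)
        + g₂ * (Nat.card {k : Fin K // ¬ IsTwoShellGood (1 / 20) (47 / 50) 1 z k ∧
            ∃ i : Fin K, IsTwoShellGood (1 / 20) (47 / 50) 1 z i ∧ dist (z i) (z k) ≤ 21 / 20} : ℝ)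
        ≤ interactionEnergy lennardJones z)) :=
  fun _ _ hθ0 hθ hg => tightContactGap_iff_core hθ0 hθ hg

end Summit.AtomisticToContinuum.Crystallization.Theorems.PhononSlackCertificatesNearFarGlueR

end
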